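import Summits.QuantumFields.YangMills.Theorems.BalabanUVNodesN16CaptureOfUnique6
import HarnessLib

/-!
# Route «BalabanUVNodes» (K3⁷ `SpineGivenEndpointR13SepCoPH`, stmt-QuantumFields-20544), DAG node N16 = NE3 — THE JUNCTION'S INTERIOR LETTER, file 2:
# CAPTURE AT EVERY CONSUMER RADIUS FROM EXISTENCE (8) AND THE UNIQUENESS SENTENCE AT ONE TOP RADIUS — `Thm1At`-FREE

Cell `pub-ymgap`, width seat `pub-ymgap-dag-n16-w4`, generation 0, file 2 — over this seat's file 1 (`BalabanUVNodesN16CaptureOfUnique6` p607700) and dag-n16-w1's file 7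
(`BalabanUVNodesN16InteriorOfCapture` p606074); re-scoped after dag-n16-w2 g4's LANDED-2 p608145 `BalabanUVNodesN16Thm1AtTorusVPSmallCubes` (`not_forall_thm1At_torusVP`: at rank
two the displayed bundle `(hGm, hG, hM, hT)` of every loose-road producer is UNINHABITED — leaf-06's `torusVP` reads (9)–(10) on ALL lattice cubes, D-s3-3).
`--kind proof --supports stmt-QuantumFields-20544 --as helper` (count-neutral).  `bears_on: R4∕N16 · junction N16 → N19`.

THE POINT.  File 1 derived CAPTURE(ε → B₃ε₁) from `hT : ∀ k, Thm1At C (torusVP …)` (used there ONLY through its existence clause (8)), the uniqueness sentence (U6) displayed for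
EVERY `ε₀ ∈ [B₃ε₁, a₀]`, and r2's `Laws` (ii) at EACH consumer radius.  Two things are sharpened here, both by file 7's VALUE logic and nothing else:
 * ONE RADIUS.  If CAPTURE holds at ONE top radius `ε⋆` and an `ε⋆`-minimiser exists at the datum, CAPTURE holds at every `ρ ≤ ε ≤ ε⋆` (`N16InteriorOfCapture.capture_mono_outer`:
   the captured `ε⋆`-minimiser lies in `sfClass ρ ⊆ sfClass ε`, so `A^{ε} = A^{ε⋆}` and every `ε`-minimiser IS an `ε⋆`-minimiser).  So (U6) and (ii) need be displayed at the
   SINGLE radius `ε⋆`: file 1's located law «(ii) at every closed ball» shrinks to «(ii) at the one closed ball `sfClass ε⋆`», the ball in which print's picture puts the minimal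
   orbit deepest inside.
 * `Thm1At`-FREE.  The regularity clause (9)–(10) plays NO role in capture: §1 displays only EXISTENCE of minimisers — at the small radius `ρ` ((8) proper) and at the top radius
   `ε⋆` — over an arbitrary data set `D`, with no constants, no local-gauge shape `G`, no cube class.  dag-n16-w2's rank-two refutation of `∀ k, Thm1At C (torusVP …)` under the
   first-order interface `hG` (a reading defect of leaf-06's cube class, NOT of print) therefore does not touch §1; §2 records the `hT`-keyed instance only as the link to file 1
   (it displays `hT` ALONE, without `hG` — not the refuted bundle — and uses (8) only).  The interior LEAF (file 1 §4–§5, file 7 §2–§4) does need (9)–(10) and stays keyed to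
   the bundle until the big-cube re-reading lands (dag-n16-w2 OFFER (o1)); it is not re-typed here.

WHAT THIS FILE PROVES (kernel, theorems only, 0 `def`, 0 sorry).  §1 ★★ `capture_of_exists_of_unique6_top` (radii `ρ ≤ ε⋆`, data `D`, a free `Crit`; displayed: `h8` existence of
`ρ`-minimisers on `D`, `hexTop` existence of `ε⋆`-minimisers on `D`, (U6)⋆ «every `Crit`-configuration of `sfClass ε⋆ ∩ {Ū = V}` is on the gauge orbit of any `ρ`-minimiser at
`V`», (ii)⋆ «`ε⋆`-minimisers are `Crit`»; conclusion: CAPTURE(ε → ρ) on `D` for EVERY `ρ ≤ ε ≤ ε⋆`), ★ `capture_of_exists_of_uniqueMinimal_top` (minimal-orbit currency: «every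
`ε⋆`-minimiser at a datum of `D` is gauge equivalent to any `ρ`-minimiser there» ∧ existence at both radii ⟹ CAPTURE at every intermediate radius), `minAct_eq_of_exists_of_unique6_top`
(then `A^{ε}(V) = A^{ε⋆}(V)` for all `ρ ≤ ε ≤ ε⋆`: the value is constant on the whole range).  §2 `capture_of_thm1At_torusVP_of_unique6_top` (the instance `ρ = B₃ε₁`,
`ε⋆ ≤ B₃a₁`, `D ⊆ sfClass ε₁ 0`, both existence rows from `hT`'s clause (8) via file 7's `exists_isMinimiser_succ_of_thm1At_torusVP`).

HONEST FRAMING.  Two applications of landed value lemmas + gauge-orbit logic (file 1 §2); (U6)⋆ ∧ (ii)⋆ and the two existence rows are DISPLAYED hypotheses, asserted for no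
family — WEAKER than file 1's displayed (U6) ∧ (ii) ∧ `hT`, still STRONGER than CAPTURE, still located at the one closed ball (file 1's honesty row (i): print's sentence is about
critical orbits of the OPEN space (6); closed-ball minimisers with an active constraint need not be critical), still ACCOUNTING and not a discharge (row (ii)); existence (8) and
uniqueness are [Balaban1985Variational] Thm 1 sentences 1–2, node N07's theorem; Props 5–7 untouched; nothing of Bałaban asserted or refuted; no stub of K3⁷ v5 closed; N16 ∕ N19 ∕
N07 NOT discharged; count-neutral (typed 28∕28 · discharged 5∕27 · A 5∕28 unmoved); one finite four-torus at fixed `ε`, Bałaban AS PRINTED — NOT ℝ⁴, NOT infinite volume, NOT OS,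
NOT a mass gap; the YM mass gap (Clay) is NOT proved by any of this — R4 closes the conditional finite-𝕋⁴ rung `BalabanLadder.UV` only; no summit statement is proved by this seat.
Context: [Balaban1985Variational] CMP **102** (1985) (2)–(8) p. 278, Thm 1 p. 279.
-/

set_option autoImplicit false

open scoped BigOperators Matrix Matrix.Norms.L2Operator
open NormedSpace

namespace Summit.QuantumFields.YangMills.BalabanUVNodes.N16CaptureOfUnique6Top

open Literature.MathematicalPhysics.QuantumFieldTheory.Balaban1983to89
open B7Prop1Explicit B7Prop2Explicit MatrixLog UnitaryModel
open T4AveragingDeficitWall hiding Site Plane Plaq Bond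
open Summit.QuantumFields.BalabanUV.T4Continuum
open MinimalActionSandwich (IsMinimiser minAct)
open MinimalActionRate (sfClass)
open MinimalActionDictionary (torusVP sfClass_mono)
open NE3EnergyShapes (IsUnitarySite IsPeriodicSite)
open B11Thm1 (Thm1At)
open Summit.QuantumFields.YangMills.BalabanUVNodes.N16InteriorOfCapture (capture_mono_outer minAct_eq_of_capture exists_isMinimiser_succ_of_thm1At_torusVP)
open Summit.QuantumFields.YangMills.BalabanUVNodes.N16CaptureOfUnique6 (capture_of_unique6_of_crit capture_of_uniqueMinimalOrbit)

noncomputable section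

variable {d : ℕ} {n : Type} [Fintype n] [DecidableEq n]

/-! ## §1 `Thm1At`-free: CAPTURE at every consumer radius from existence at two radii and uniqueness at the top one -/

/-- **★★ CAPTURE(ε → ρ) ON `D` FOR EVERY `ρ ≤ ε ≤ ε⋆`, FROM EXISTENCE AT `ρ` AND AT `ε⋆` AND THE UNIQUENESS SENTENCE AT THE ONE RADIUS `ε⋆`.**  `Crit` is a free predicate.
Displayed: `h8` — every datum of `D` carries a minimiser of every run `k+1` over `sfClass d L N ρ` ([Balaban1985Variational] Thm 1 (8) at the datum radius `ρ∕B₃`); `hexTop` — likewise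
over `sfClass d L N ε⋆` ((8) at `ε⋆∕B₃`); `hU6top` — Thm 1 sentence 2 ∘ r2 `Laws` (iv) at the pair `(ρ, ε⋆)`: every `Crit`-configuration of `sfClass d L N ε⋆ (k+1) ∩ {Ū = V}` lies on
the gauge orbit of any `ρ`-minimiser `U₀` at `V`; `hcritTop` — `Laws` (ii) at `ε⋆`.  Proof: file 1 §2 gives CAPTURE(ε⋆ → ρ); file 7's `capture_mono_outer` carries it to every
intermediate radius.  No constants, no local gauges, no cube class. [cite: Balaban1985Variational, Thm 1 p.279] -/
theorem capture_of_exists_of_unique6_top [Nonempty n] {L N : ℕ} {ρ εTop : ℝ} {D : Set (Site d → Fin d → (Matrix n n ℂ)ˣ)}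
    (Crit : ℕ → (Site d → Fin d → (Matrix n n ℂ)ˣ) → (Site d → Fin d → (Matrix n n ℂ)ˣ) → Prop)
    (h8 : ∀ V ∈ D, ∀ k : ℕ, ∃ U₀ : Site d → Fin d → (Matrix n n ℂ)ˣ, IsMinimiser d (sfClass d L N ρ) L N (k + 1) V U₀)
    (hexTop : ∀ V ∈ D, ∀ k : ℕ, ∃ U : Site d → Fin d → (Matrix n n ℂ)ˣ, IsMinimiser d (sfClass d L N εTop) L N (k + 1) V U)
    (hU6top : ∀ (k : ℕ), ∀ V ∈ D, ∀ U₀ : Site d → Fin d → (Matrix n n ℂ)ˣ, IsMinimiser d (sfClass d L N ρ) L N (k + 1) V U₀ →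
      ∀ U : Site d → Fin d → (Matrix n n ℂ)ˣ, U ∈ sfClass d L N εTop (k + 1) → avgIter L U (k + 1) = V → Crit k V U →
        ∃ u : Site d → (Matrix n n ℂ)ˣ, IsUnitarySite u ∧ IsPeriodicSite u ((N * L ^ (k + 1) : ℕ) : ℤ) ∧ gaugeAct u U₀ = U)
    (hcritTop : ∀ (k : ℕ) (V U : Site d → Fin d → (Matrix n n ℂ)ˣ), IsMinimiser d (sfClass d L N εTop) L N (k + 1) V U → Crit k V U)
    {ε : ℝ} (hρε : ρ ≤ ε) (hεT : ε ≤ εTop) :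
    ∀ V ∈ D, ∀ (k : ℕ) (U : Site d → Fin d → (Matrix n n ℂ)ˣ),
      IsMinimiser d (sfClass d L N ε) L N (k + 1) V U → U ∈ sfClass d L N ρ (k + 1) := by
  -- CAPTURE at the top radius (file 1 §2 at each datum, with its own `ρ`-minimiser as the (8)-witness)
  have hcapTop : ∀ V ∈ D, ∀ (k : ℕ) (U : Site d → Fin d → (Matrix n n ℂ)ˣ),
      IsMinimiser d (sfClass d L N εTop) L N (k + 1) V U → U ∈ sfClass d L N ρ (k + 1) := by
    intro V hV k U hU
    obtain ⟨U₀, hU₀⟩ := h8 V hV k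
    exact capture_of_unique6_of_crit (Crit k) hU₀ (hU6top k V hV U₀ hU₀) (hcritTop k V) hU
  exact capture_mono_outer hρε hεT hcapTop hexTop

/-- **★ THE SAME IN MINIMAL-ORBIT CURRENCY AT THE ONE RADIUS**: existence at `ρ` and at `ε⋆` on `D`, and «every minimiser of run `k+1` over `sfClass d L N ε⋆` at a datum of `D` is gauge
equivalent to any `ρ`-minimiser there» ⟹ CAPTURE(ε → ρ) on `D` for every `ρ ≤ ε ≤ ε⋆`. [cite: Balaban1985Variational, Thm 1 p.279] -/
theorem capture_of_exists_of_uniqueMinimal_top [Nonempty n] {L N : ℕ} {ρ εTop : ℝ} {D : Set (Site d → Fin d → (Matrix n n ℂ)ˣ)}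
    (h8 : ∀ V ∈ D, ∀ k : ℕ, ∃ U₀ : Site d → Fin d → (Matrix n n ℂ)ˣ, IsMinimiser d (sfClass d L N ρ) L N (k + 1) V U₀)
    (hexTop : ∀ V ∈ D, ∀ k : ℕ, ∃ U : Site d → Fin d → (Matrix n n ℂ)ˣ, IsMinimiser d (sfClass d L N εTop) L N (k + 1) V U)
    (hU6m : ∀ (k : ℕ), ∀ V ∈ D, ∀ U₀ : Site d → Fin d → (Matrix n n ℂ)ˣ, IsMinimiser d (sfClass d L N ρ) L N (k + 1) V U₀ →
      ∀ U : Site d → Fin d → (Matrix n n ℂ)ˣ, IsMinimiser d (sfClass d L N εTop) L N (k + 1) V U →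
        ∃ u : Site d → (Matrix n n ℂ)ˣ, IsUnitarySite u ∧ IsPeriodicSite u ((N * L ^ (k + 1) : ℕ) : ℤ) ∧ gaugeAct u U₀ = U)
    {ε : ℝ} (hρε : ρ ≤ ε) (hεT : ε ≤ εTop) :
    ∀ V ∈ D, ∀ (k : ℕ) (U : Site d → Fin d → (Matrix n n ℂ)ˣ),
      IsMinimiser d (sfClass d L N ε) L N (k + 1) V U → U ∈ sfClass d L N ρ (k + 1) := by
  have hcapTop : ∀ V ∈ D, ∀ (k : ℕ) (U : Site d → Fin d → (Matrix n n ℂ)ˣ),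
      IsMinimiser d (sfClass d L N εTop) L N (k + 1) V U → U ∈ sfClass d L N ρ (k + 1) := by
    intro V hV k U hU
    obtain ⟨U₀, hU₀⟩ := h8 V hV k
    exact capture_of_uniqueMinimalOrbit hU₀ (hU6m k V hV U₀ hU₀) hU
  exact capture_mono_outer hρε hεT hcapTop hexTop

/-- **THE MINIMAL ACTION IS CONSTANT ON THE WHOLE RANGE OF RADII**: under §1's hypotheses, `A^{ε}_{k+1}(V) = A^{ε⋆}_{k+1}(V)` for every `ρ ≤ ε ≤ ε⋆` and every datum of `D` — the
captured `ε⋆`-minimiser is a minimiser of every intermediate class (file 7's `minAct_eq_of_capture`). [folklore] -/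
theorem minAct_eq_of_exists_of_unique6_top [Nonempty n] {L N : ℕ} {ρ εTop : ℝ} {D : Set (Site d → Fin d → (Matrix n n ℂ)ˣ)}
    (Crit : ℕ → (Site d → Fin d → (Matrix n n ℂ)ˣ) → (Site d → Fin d → (Matrix n n ℂ)ˣ) → Prop)
    (h8 : ∀ V ∈ D, ∀ k : ℕ, ∃ U₀ : Site d → Fin d → (Matrix n n ℂ)ˣ, IsMinimiser d (sfClass d L N ρ) L N (k + 1) V U₀)
    (hexTop : ∀ V ∈ D, ∀ k : ℕ, ∃ U : Site d → Fin d → (Matrix n n ℂ)ˣ, IsMinimiser d (sfClass d L N εTop) L N (k + 1) V U)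
    (hU6top : ∀ (k : ℕ), ∀ V ∈ D, ∀ U₀ : Site d → Fin d → (Matrix n n ℂ)ˣ, IsMinimiser d (sfClass d L N ρ) L N (k + 1) V U₀ →
      ∀ U : Site d → Fin d → (Matrix n n ℂ)ˣ, U ∈ sfClass d L N εTop (k + 1) → avgIter L U (k + 1) = V → Crit k V U →
        ∃ u : Site d → (Matrix n n ℂ)ˣ, IsUnitarySite u ∧ IsPeriodicSite u ((N * L ^ (k + 1) : ℕ) : ℤ) ∧ gaugeAct u U₀ = U)
    (hcritTop : ∀ (k : ℕ) (V U : Site d → Fin d → (Matrix n n ℂ)ˣ), IsMinimiser d (sfClass d L N εTop) L N (k + 1) V U → Crit k V U)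
    {ε : ℝ} (hρε : ρ ≤ ε) (hεT : ε ≤ εTop) {V : Site d → Fin d → (Matrix n n ℂ)ˣ} (hV : V ∈ D) (k : ℕ) :
    minAct d (sfClass d L N ε) L N (k + 1) V = minAct d (sfClass d L N εTop) L N (k + 1) V := by
  obtain ⟨U, hU⟩ := hexTop V hV k
  obtain ⟨U₀, hU₀⟩ := h8 V hV k
  have hmem : U ∈ sfClass d L N ρ (k + 1) := capture_of_unique6_of_crit (Crit k) hU₀ (hU6top k V hV U₀ hU₀) (hcritTop k V) hU
  exact minAct_eq_of_capture hρε hεT hU hmem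

/-! ## §2 The instance keyed to Theorem 1's existence clause (8) at leaf-06's torus instances (link to file 1 §3) -/

/-- **CAPTURE(ε → B₃ε₁) FOR EVERY `B₃ε₁ ≤ ε ≤ ε⋆` ON LOOSE DATA, WITH BOTH EXISTENCE ROWS READ FROM (8).**  Displayed: `hT : ∀ k, Thm1At C (torusVP …)` — used ONLY through its
existence clause (8), at `ε₁` and at `ε⋆∕B₃ ≤ a₁` (file 7's `exists_isMinimiser_succ_of_thm1At_torusVP`); (U6)⋆ and (ii)⋆ at the one radius `ε⋆` as in §1 (here over
`D ⊆ sfClass d L N ε₁ 0`).  `hT` is displayed ALONE — without the local-gauge interface `hG` of the leaf producers, so this is not the bundle dag-n16-w2's `not_forall_thm1At_torusVP`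
refutes; a consumer holding only (8) uses §1 directly. [cite: Balaban1985Variational, Thm 1 (8) p.279] -/
theorem capture_of_thm1At_torusVP_of_unique6_top [Nonempty n] {L N : ℕ}
    {G : (Site d → Fin d → (Matrix n n ℂ)ˣ) → Site d → ℕ → ℝ → ℝ → ℝ → Prop}
    (C : B11Thm1.Consts) (hT : ∀ k : ℕ, Thm1At C (torusVP d L N G (k + 1)))
    (Crit : ℕ → (Site d → Fin d → (Matrix n n ℂ)ˣ) → (Site d → Fin d → (Matrix n n ℂ)ˣ) → Prop)
    {ε₁ εTop : ℝ} (hε₁ : 0 < ε₁) (hρT : C.B₃ * ε₁ ≤ εTop) (hTa₁ : εTop ≤ C.B₃ * C.a₁)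
    {D : Set (Site d → Fin d → (Matrix n n ℂ)ˣ)} (hD : D ⊆ sfClass d L N ε₁ 0)
    (hU6top : ∀ (k : ℕ), ∀ V ∈ D, ∀ U₀ : Site d → Fin d → (Matrix n n ℂ)ˣ, IsMinimiser d (sfClass d L N (C.B₃ * ε₁)) L N (k + 1) V U₀ →
      ∀ U : Site d → Fin d → (Matrix n n ℂ)ˣ, U ∈ sfClass d L N εTop (k + 1) → avgIter L U (k + 1) = V → Crit k V U →
        ∃ u : Site d → (Matrix n n ℂ)ˣ, IsUnitarySite u ∧ IsPeriodicSite u ((N * L ^ (k + 1) : ℕ) : ℤ) ∧ gaugeAct u U₀ = U)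
    (hcritTop : ∀ (k : ℕ) (V U : Site d → Fin d → (Matrix n n ℂ)ˣ), IsMinimiser d (sfClass d L N εTop) L N (k + 1) V U → Crit k V U)
    {ε : ℝ} (hρε : C.B₃ * ε₁ ≤ ε) (hεT : ε ≤ εTop) :
    ∀ V ∈ D, ∀ (k : ℕ) (U : Site d → Fin d → (Matrix n n ℂ)ˣ),
      IsMinimiser d (sfClass d L N ε) L N (k + 1) V U → U ∈ sfClass d L N (C.B₃ * ε₁) (k + 1) := by
  have hB₃ := C.B₃_pos
  have hρ : 0 < C.B₃ * ε₁ := mul_pos hB₃ hε₁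
  have hρa₁ : C.B₃ * ε₁ ≤ C.B₃ * C.a₁ := hρT.trans hTa₁
  have hTpos : 0 < εTop := lt_of_lt_of_le hρ hρT
  -- (8) at the datum radius `ε₁ = (B₃ε₁)∕B₃` and at `ε⋆∕B₃`
  have hDρ : D ⊆ sfClass d L N (C.B₃ * ε₁ / C.B₃) 0 := fun V hV => by
    rw [mul_div_cancel_left₀ _ hB₃.ne']; exact hD hV
  have hDT : D ⊆ sfClass d L N (εTop / C.B₃) 0 := fun V hV =>
    sfClass_mono (by rw [le_div_iff₀ hB₃, mul_comm]; exact hρT) (hD hV)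
  exact capture_of_exists_of_unique6_top Crit
    (fun V hV k => exists_isMinimiser_succ_of_thm1At_torusVP C hT hρ hρa₁ (hDρ hV) k)
    (fun V hV k => exists_isMinimiser_succ_of_thm1At_torusVP C hT hTpos hTa₁ (hDT hV) k)
    hU6top hcritTop hρε hεT

end

end Summit.QuantumFields.YangMills.BalabanUVNodes.N16CaptureOfUnique6Top
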